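import Summits.Ventures.DiscreteObjects.UnitDistance.FieldPlanesCriterion
import Summits.Ventures.DiscreteObjects.UnitDistance.ThreeAdicCriterion
import Summits.Ventures.DiscreteObjects.UnitDistance.PadicCriterion
import Summits.Ventures.DiscreteObjects.UnitDistance.OddCycles

/-!
# Atlas of real quadratic and biquadratic planes: `χ(ℚ(√d)²)` and `χ(ℚ(√a, √b)²)` in the kernel
(cell `pub-namedobj`, target (U), seat udg g11)

Framing (verbatim for the cell): lottery ticket; floor = certified bounds/negative ranges.

Everything assembled: the 2-adic criterion (`MultiquadraticCriterion`, `FieldPlanesCriterion`), the 3-adic criterion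
(`ThreeAdicCriterion`), the `7/11/19`-adic criteria (`PadicCriterion`), the odd cycles (`OddCycles`), the triangle and the
Moser spindle (`FieldPlanes`).

* THE QUADRATIC DICHOTOMY (kernel; Johnson 1987 + odd cycles): for `4 ∤ d`, `ℚ(√d)²` is bipartite iff `d ≢ 3 (mod 4)`
  (`colorable_two_plane_sqrt_iff`); `χ(ℚ(√d)²) = 2` iff `d ≡ 1, 2 (mod 4)`.
* `χ(ℚ(√d)²) = 3` for every `d ≡ 3 (mod 4)` with `d ≡ 1 (mod 3)` or `d ≡ 3, 6 (mod 9)` (`chromaticNumber_plane_sqrt_eq_three`: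
  `d = 3, 7, 15, 19, 31, 39, 43, 51, 55, …`; `d = 3, 7` are Madore 2015 Props. 4.1/4.2; the upper bounds are explicit instances
  of Madore's Cor. 3.2 at `q = 3`, the odd cycles were not found in print);
  `3 ≤ χ(ℚ(√d)²) ≤ 4` for `d ≡ 3 (mod 8)` (`d = 11, 35, 59, …`) and for `7`-adic `d` (`d = 23`).
* TABLE for square-free `d ≤ 40`: `χ = 2` for the sixteen `d ≢ 3 (mod 4)`, `χ = 3` for `d ∈ {3, 7, 15, 19, 31, 39}`,
  `χ ∈ {3, 4}` for `d ∈ {11, 23, 35}` — every square-free `d ≤ 40` is decided up to one unit (`quadratic_table_le_40`).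
* BIQUADRATIC ATLAS (`biquadratic_atlas_30`): of the `153` fields `ℚ(√a, √b)`, `a < b ≤ 30` square-free, `147` are COVERED by
  one of the five criteria (`Covered`, decidable; ⇒ `χ ≤ 5`, no 6-chromatic unit-distance graph lives there), and exactly six
  — `(3,29), (10,23), (11,13), (13,23), (15,17), (19,29)` — survive all five (the kernel form of the cell's FIELD ATLAS,
  udg g3 TABLE-U3: there the surviving fields were certified open at ORDER 1 for every prime, since the killer residue fields
  are exactly `𝔽₃, 𝔽₇, 𝔽₁₁, 𝔽₁₉`; not restated here).
Nothing here is literature; the quadratic values `d ≡ 1,2 (4)` / `d = 3, 7` are replications (Johnson 1987, Fischer 1990,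
Madore 2015), every `p`-adic upper bound with `p` odd is an explicit instance of Madore 2015 Cor. 3.2 (replication-grade
mechanism); the 2-adic criterion, the odd cycles and the atlas statements were not found in the held corpus (PROVISIONAL,
'ours as far as searched' — FRESHNESS F-U17/F-U19).
-/

noncomputable section

namespace Summit.Ventures.DiscreteObjects.UnitDistance

open SimpleGraph IntermediateField
open scoped IntermediateField

/-! ## Quadratic fields -/

/-- THE QUADRATIC DICHOTOMY: for `4 ∤ d`, the unit-distance graph of `ℚ(√d)²` is bipartite iff `d ≢ 3 (mod 4)`. -/
theorem colorable_two_plane_sqrt_iff (d : ℕ) (hd : d % 4 ≠ 0) :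
    (planeUnitDistanceGraph.induce (fieldPoints ℚ⟮Real.sqrt d⟯)).Colorable 2 ↔ d % 4 ≠ 3 := by
  constructor
  · intro h h3
    exact not_colorable_two_plane_sqrt d h3 h
  · intro h3
    rw [← multiSqrtField_singleton]
    apply colorable_two_plane_of_squareClasses
    unfold SquareClassesAvoidNegOneAndThree
    simp only [Finset.mem_singleton, forall_eq]
    omega

/-- `χ(ℚ(√d)²) = 2` iff `d ≡ 1, 2 (mod 4)` (for `4 ∤ d`). -/
theorem chromaticNumber_plane_sqrt_eq_two_iff (d : ℕ) (hd : d % 4 ≠ 0) :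
    (planeUnitDistanceGraph.induce (fieldPoints ℚ⟮Real.sqrt d⟯)).chromaticNumber = 2 ↔ d % 4 ≠ 3 := by
  constructor
  · intro h h3
    have hc : (planeUnitDistanceGraph.induce (fieldPoints ℚ⟮Real.sqrt d⟯)).Colorable 2 := by
      rw [show (2 : ℕ∞) = (1 : ℕ) + 1 by norm_num] at h
      exact (chromaticNumber_eq_iff_colorable_not_colorable.mp h).1
    exact not_colorable_two_plane_sqrt d h3 hc
  · intro h3
    exact chromaticNumber_plane_sqrt_eq_two d (by omega)

/-- `χ(ℚ(√d)²) = 3` EXACTLY for every `d ≡ 3 (mod 4)` in the 3-adic pattern (`d ≡ 1 mod 3` or `d ≡ 3, 6 mod 9`):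
`d = 3, 7, 15, 19, 31, 39, 43, 51, 55, 67, …` (odd zigzag cycle + 3-adic reduction). -/
theorem chromaticNumber_plane_sqrt_eq_three (d : ℕ) (h4 : d % 4 = 3) (h3 : d % 3 = 1 ∨ d % 9 = 3 ∨ d % 9 = 6) :
    (planeUnitDistanceGraph.induce (fieldPoints ℚ⟮Real.sqrt d⟯)).chromaticNumber = 3 := by
  rw [show (3 : ℕ∞) = (2 : ℕ) + 1 by norm_num]
  exact chromaticNumber_eq_iff_colorable_not_colorable.mpr
    ⟨colorable_three_plane_quadratic d h3, not_colorable_two_plane_sqrt d h4⟩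

/-- Multiquadratic form: `χ(ℚ(√e : e ∈ S)²) = 3` EXACTLY whenever `S` fits a 3-adic pattern and some `d ∈ S` is `≡ 3 (mod 4)`
(e.g. `ℚ(√7, √13, √19)`, `ℚ(√6, √7, √15, √33)`, `ℚ(√3, √7, √21, √31)`). -/
theorem chromaticNumber_plane_eq_three_of_mem_mod_four (S : Finset ℕ) (hS : ThreeAdicPattern S) {d : ℕ} (hd : d ∈ S)
    (h4 : d % 4 = 3) : (planeUnitDistanceGraph.induce (fieldPoints (multiSqrtField S))).chromaticNumber = 3 := by
  rw [show (3 : ℕ∞) = (2 : ℕ) + 1 by norm_num]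
  exact chromaticNumber_eq_iff_colorable_not_colorable.mpr
    ⟨colorable_three_plane_threeAdic S hS, not_colorable_two_plane_multiSqrtField hd h4⟩

/-- Examples not found in print (PROVISIONAL): `χ(ℚ(√7, √13, √19)²) = 3` and `χ(ℚ(√6, √7, √15, √33)²) = 3`. -/
theorem chromaticNumber_plane_eq_three_examples :
    (planeUnitDistanceGraph.induce (fieldPoints (multiSqrtField {7, 13, 19}))).chromaticNumber = 3 ∧
      (planeUnitDistanceGraph.induce (fieldPoints (multiSqrtField {6, 7, 15, 33}))).chromaticNumber = 3 :=
  ⟨chromaticNumber_plane_eq_three_of_mem_mod_four _ (by decide) (d := 7) (by decide) (by norm_num),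
    chromaticNumber_plane_eq_three_of_mem_mod_four _ (by decide) (d := 7) (by decide) (by norm_num)⟩

/-- MADORE 2015 Prop. 4.2 in the kernel: `χ(ℚ(√7)²) = 3` (triangle-free, yet not bipartite; the kernel lower bound is the
zigzag `7`-cycle of `OddCycles` on `(0,0), (3/4, √7/4), (3/2, 0), (9/4, √7/4), (3, 0), (2, 0), (1, 0)` — Madore's own witness is a
`9`-cycle with step `(1/8, 3√7/8)`; the upper bound is his Cor. 3.2 at the prime `√7 − 2` of norm `3`). -/
theorem chromaticNumber_plane_sqrt7 :
    (planeUnitDistanceGraph.induce (fieldPoints ℚ⟮Real.sqrt 7⟯)).chromaticNumber = 3 := by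
  have h := chromaticNumber_plane_sqrt_eq_three 7 (by norm_num) (by norm_num)
  rwa [Nat.cast_ofNat] at h

/-- Not found in print (PROVISIONAL): `χ(ℚ(√15)²) = 3` and `χ(ℚ(√19)²) = 3`. -/
theorem chromaticNumber_plane_sqrt15_sqrt19 :
    (planeUnitDistanceGraph.induce (fieldPoints ℚ⟮Real.sqrt 15⟯)).chromaticNumber = 3 ∧
      (planeUnitDistanceGraph.induce (fieldPoints ℚ⟮Real.sqrt 19⟯)).chromaticNumber = 3 := by
  have h15 := chromaticNumber_plane_sqrt_eq_three 15 (by norm_num) (by norm_num)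
  have h19 := chromaticNumber_plane_sqrt_eq_three 19 (by norm_num) (by norm_num)
  rw [Nat.cast_ofNat] at h15 h19
  exact ⟨h15, h19⟩

/-- `3 ≤ χ(ℚ(√d)²) ≤ 4` for every `d ≡ 3 (mod 8)` (odd cycle + 2-adic criterion, Fischer's case): `d = 11, 35, 59, …`. -/
theorem plane_sqrt_three_four_of_mod_eight (d : ℕ) (h8 : d % 8 = 3) :
    ¬ (planeUnitDistanceGraph.induce (fieldPoints ℚ⟮Real.sqrt d⟯)).Colorable 2 ∧
      (planeUnitDistanceGraph.induce (fieldPoints ℚ⟮Real.sqrt d⟯)).Colorable 4 := by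
  refine ⟨not_colorable_two_plane_sqrt d (by omega), ?_⟩
  rw [← multiSqrtField_singleton]
  apply colorable_four_plane_of_squareClasses
  unfold SquareClassesAvoidNegOne
  simp only [Finset.mem_singleton, forall_eq]
  omega

/-- `3 ≤ χ(ℚ(√23)²) ≤ 4` (odd `23`-cycle + `7`-adic criterion: `23 ≡ 2 = 3²` mod `7`). -/
theorem plane_sqrt23_three_four :
    ¬ (planeUnitDistanceGraph.induce (fieldPoints (multiSqrtField {23}))).Colorable 2 ∧
      (planeUnitDistanceGraph.induce (fieldPoints (multiSqrtField {23}))).Colorable 4 :=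
  ⟨not_colorable_two_plane_multiSqrtField (d := 23) (by decide) (by norm_num),
    colorable_four_plane_of_sevenAdic _ (by decide)⟩

/-- THE QUADRATIC TABLE for square-free `d ≤ 40`: `χ(ℚ(√d)²) = 2` for the sixteen `d ≢ 3 (mod 4)`; `= 3` for
`d ∈ {3, 7, 15, 19, 31, 39}`; `∈ {3, 4}` for `d ∈ {11, 23, 35}` (stated as: not `2`-colourable and `4`-colourable). -/
theorem quadratic_table_le_40 :
    (∀ d ∈ ({2, 5, 6, 10, 13, 14, 17, 21, 22, 26, 29, 30, 33, 34, 37, 38} : Finset ℕ),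
        (planeUnitDistanceGraph.induce (fieldPoints (multiSqrtField {d}))).chromaticNumber = 2) ∧
    (∀ d ∈ ({3, 7, 15, 19, 31, 39} : Finset ℕ),
        (planeUnitDistanceGraph.induce (fieldPoints (multiSqrtField {d}))).chromaticNumber = 3) ∧
    (∀ d ∈ ({11, 23, 35} : Finset ℕ),
        ¬ (planeUnitDistanceGraph.induce (fieldPoints (multiSqrtField {d}))).Colorable 2 ∧
          (planeUnitDistanceGraph.induce (fieldPoints (multiSqrtField {d}))).Colorable 4) := by
  refine ⟨?_, ?_, ?_⟩
  · intro d hd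
    rw [multiSqrtField_singleton]
    apply chromaticNumber_plane_sqrt_eq_two
    simp only [Finset.mem_insert, Finset.mem_singleton] at hd
    rcases hd with rfl | rfl | rfl | rfl | rfl | rfl | rfl | rfl | rfl | rfl | rfl | rfl | rfl | rfl | rfl | rfl <;>
      norm_num
  · intro d hd
    rw [multiSqrtField_singleton]
    simp only [Finset.mem_insert, Finset.mem_singleton] at hd
    rcases hd with rfl | rfl | rfl | rfl | rfl | rfl <;>
      exact chromaticNumber_plane_sqrt_eq_three _ (by norm_num) (by norm_num)
  · intro d hd
    simp only [Finset.mem_insert, Finset.mem_singleton] at hd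
    rcases hd with rfl | rfl | rfl
    · rw [multiSqrtField_singleton]; exact plane_sqrt_three_four_of_mod_eight 11 (by norm_num)
    · exact plane_sqrt23_three_four
    · rw [multiSqrtField_singleton]; exact plane_sqrt_three_four_of_mod_eight 35 (by norm_num)

/-! ## Exact value four from VND's `L₁₀` -/

/-- `√2, √3 ∈ K` ⇒ the 10-vertex 4-chromatic graph `L₁₀` of Voronov–Neopryatnaya–Dergachev (kernel: udg g3's
`FourChromaticSqrt2Sqrt3`, placed in `ℚ(√2,√3)²` by udg g10) lies in `K²`, so `χ(K²) ≥ 4`. -/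
theorem not_colorable_three_plane_of_sqrt2_sqrt3 (K : IntermediateField ℚ ℝ) (h2 : Real.sqrt 2 ∈ K)
    (h3 : Real.sqrt 3 ∈ K) : ¬ (planeUnitDistanceGraph.induce (fieldPoints K)).Colorable 3 := by
  have hle : sqrt2sqrt3Field ≤ K := by
    change multiSqrtField {2, 3} ≤ K
    unfold multiSqrtField
    rw [IntermediateField.adjoin_le_iff]
    rintro x ⟨d, hd, rfl⟩
    have hd' : d = 2 ∨ d = 3 := by simpa using hd
    rcases hd' with rfl | rfl
    · exact h2
    · exact h3
  intro hK
  have h' : (planeUnitDistanceGraph.induce sqrt2sqrt3Points).Colorable 3 := colorable_plane_of_le hle hK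
  exact VNDL10.not_colorable_three (h'.of_hom l10HomPlane)

/-- `χ(ℚ(√d : d ∈ S)²) = 4` EXACTLY when the square classes of `S` avoid `[−1]` and `2, 3 ∈ S` (pattern `⟨[2],[3]⟩`). -/
theorem chromaticNumber_plane_eq_four_of_sqrt2_sqrt3 (S : Finset ℕ) (hS : SquareClassesAvoidNegOne S) (h2 : 2 ∈ S)
    (h3 : 3 ∈ S) : (planeUnitDistanceGraph.induce (fieldPoints (multiSqrtField S))).chromaticNumber = 4 := by
  rw [show (4 : ℕ∞) = (3 : ℕ) + 1 by norm_num]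
  refine chromaticNumber_eq_iff_colorable_not_colorable.mpr ⟨colorable_four_plane_of_squareClasses S hS, ?_⟩
  refine not_colorable_three_plane_of_sqrt2_sqrt3 _ ?_ ?_
  · simpa using sqrt_mem_multiSqrtField (S := S) (d := 2) h2
  · simpa using sqrt_mem_multiSqrtField (S := S) (d := 3) h3

/-- Example not found in print (PROVISIONAL): `χ(ℚ(√2, √3, √11, √17, √19, √22)²) = 4`. -/
theorem chromaticNumber_plane_example_23 :
    (planeUnitDistanceGraph.induce (fieldPoints (multiSqrtField {2, 3, 11, 17, 19, 22}))).chromaticNumber = 4 :=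
  chromaticNumber_plane_eq_four_of_sqrt2_sqrt3 _ (by decide) (by decide) (by decide)

/-! ## Covered multiquadratic fields: any of the five criteria -/

/-- `S` is COVERED by one of the five kernel criteria (2-adic, 3-adic, `7`-, `11`-, `19`-adic). -/
def Covered (S : Finset ℕ) : Prop :=
  SquareClassesAvoidNegOne S ∨ ThreeAdicPattern S ∨ PadicPattern 7 S ∨ PadicPattern 11 S ∨ PadicPattern 19 S

/-- `Covered` is decidable (`decide` for concrete `S`). -/
instance (S : Finset ℕ) : Decidable (Covered S) := by unfold Covered; infer_instance

/-- A COVERED field plane is `5`-colourable: NO 6-chromatic unit-distance graph has all coordinates in it. -/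
theorem colorable_five_plane_of_covered (S : Finset ℕ) (hS : Covered S) :
    (planeUnitDistanceGraph.induce (fieldPoints (multiSqrtField S))).Colorable 5 := by
  rcases hS with h | h | h | h | h
  · exact (colorable_four_plane_of_squareClasses S h).mono (by norm_num)
  · exact (colorable_three_plane_threeAdic S h).mono (by norm_num)
  · exact (colorable_four_plane_of_sevenAdic S h).mono (by norm_num)
  · exact colorable_five_plane_of_elevenAdic S h
  · exact colorable_five_plane_of_nineteenAdic S h

/-- Census form: a unit-distance graph that is NOT `5`-colourable (a witness of target (U)) has a coordinate outside
`ℚ(√d : d ∈ S)` for every COVERED `S`. -/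
theorem sixChromatic_witness_leaves_covered {V : Type*} {G : SimpleGraph V} {q : V → EuclideanSpace ℝ (Fin 2)}
    (hq : IsUnitDistanceRealisation G q) (h5 : ¬ G.Colorable 5) (S : Finset ℕ) (hS : Covered S) :
    ∃ v i, q v i ∉ multiSqrtField S := by
  by_contra hall
  push Not at hall
  apply h5
  rcases hS with h | h | h | h | h
  · exact (colorable_four_of_realisation_in_squareClasses S h hq hall).mono (by norm_num)
  · exact (colorable_three_of_realisation_threeAdic S h hq hall).mono (by norm_num)
  · exact (colorable_of_realisation_padicPattern 7 (by norm_num) unitCircleGraph_zmod7_colorable_four S h hq hall).mono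
      (by norm_num)
  · exact colorable_of_realisation_padicPattern 11 (by norm_num) unitCircleGraph_zmod11_colorable_five S h hq hall
  · exact colorable_of_realisation_padicPattern 19 (by norm_num) unitCircleGraph_zmod19_colorable_five S h hq hall

/-! ## All quadratic fields `ℚ(√d)`, `d < 167` -/

set_option maxRecDepth 20000 in
/-- THE QUADRATIC COVERAGE THEOREM (kernel, by `decide`): for every `0 < d < 167` except `d = 164`, the field `ℚ(√d)` is covered
by one of the five criteria — so `χ(ℚ(√d)²) ≤ 5` and no 6-chromatic unit-distance graph lives in `ℚ(√d)²`.  (`164 = 4·41` is an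
artefact of the residue patterns, which do not see `ℚ(√164) = ℚ(√41)`, covered; so `d = 167` — a prime `≡ 7 (mod 8)`, `≡ 2 (mod 3)`,
a non-residue mod `7, 11, 19` — is the first square-free exception.  The Python mirror `code/udg11/atlas.py` lists the square-free
exceptions below `3000`: `167, 887, 1055, 1319, 1823, 2351, 2735, 2903`.) -/
theorem quadratic_covered_lt_167 : ∀ d ∈ Finset.range 167, d ≠ 0 → d ≠ 164 → Covered {d} := by
  decide

/-- …and `d = 167` is genuinely uncovered by the five criteria (as is `887`). -/
theorem quadratic_exceptions_not_covered : ¬ Covered {167} ∧ ¬ Covered {887} := by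
  decide

/-! ## The biquadratic atlas `a < b ≤ 30` -/

/-- The square-free numbers `2 ≤ d ≤ 30`. -/
def squarefree30 : Finset ℕ := {2, 3, 5, 6, 7, 10, 11, 13, 14, 15, 17, 19, 21, 22, 23, 26, 29, 30}

/-- The six biquadratic SURVIVORS `ℚ(√a, √b)`, `a < b ≤ 30`, of all five criteria. -/
def biquadraticSurvivors30 : Finset (ℕ × ℕ) := {(3, 29), (10, 23), (11, 13), (13, 23), (15, 17), (19, 29)}

/-- THE BIQUADRATIC ATLAS (kernel, by `decide`): every field `ℚ(√a, √b)` with `a < b` square-free `≤ 30` is COVERED by one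
of the five criteria, except the six survivors. -/
theorem biquadratic_atlas_30 :
    ∀ a ∈ squarefree30, ∀ b ∈ squarefree30, a < b → (a, b) ∉ biquadraticSurvivors30 → Covered {a, b} := by
  decide

/-- The six survivors are genuinely uncovered by the five criteria (so nothing was hidden in the exception list). -/
theorem biquadraticSurvivors30_not_covered : ∀ ab ∈ biquadraticSurvivors30, ¬ Covered {ab.1, ab.2} := by
  decide

/-- CENSUS CONSEQUENCE: a 6-chromatic unit-distance graph (a witness of target (U)) cannot have all its coordinates in
any biquadratic field `ℚ(√a, √b)`, `a < b ≤ 30` square-free, other than (possibly) the six survivors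
`ℚ(√3,√29), ℚ(√10,√23), ℚ(√11,√13), ℚ(√13,√23), ℚ(√15,√17), ℚ(√19,√29)`. -/
theorem sixChromatic_witness_leaves_biquadratic_30 {V : Type*} {G : SimpleGraph V}
    {q : V → EuclideanSpace ℝ (Fin 2)} (hq : IsUnitDistanceRealisation G q) (h5 : ¬ G.Colorable 5)
    {a b : ℕ} (ha : a ∈ squarefree30) (hb : b ∈ squarefree30) (hab : a < b) (hs : (a, b) ∉ biquadraticSurvivors30) :
    ∃ v i, q v i ∉ multiSqrtField {a, b} :=
  sixChromatic_witness_leaves_covered hq h5 _ (biquadratic_atlas_30 a ha b hb hab hs)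

/-- HONEST NEGATIVES for the census: the five kernel criteria do NOT touch the VND field `ℚ(√2, √3, √5)` (home of the
64513-vertex graph of Voronov–Neopryatnaya–Dergachev 2022) nor de Grey's field `ℚ(√3, √5, √7, √11)` — consistent with the
cell's order-1 atlas (udg g3/g4/g8: both are reduction-proof; first eligible primes `71` and `131`, not killers). -/
theorem vnd_and_deGrey_fields_not_covered : ¬ Covered {2, 3, 5} ∧ ¬ Covered {3, 5, 7, 11} := by
  decide

/-- …whereas Heule's field `ℚ(√3, √5, √11)` and the Exoo–Ismailescu field `ℚ(√3, √11, √247)` ARE covered (by `11`). -/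
theorem heule_and_exooIsmailescu_fields_covered : Covered {3, 5, 11} ∧ Covered {3, 11, 247} := by
  decide

end Summit.Ventures.DiscreteObjects.UnitDistance
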